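import Summits.BirchSwinnertonDyer.BirchSwinnertonDyer.Theorems.ManinLocalTwoThreeTameThreeIstarZeroTorsion
import Summits.BirchSwinnertonDyer.BirchSwinnertonDyer.Theorems.ManinLocalTwoThreeIstarJValuation
import Summits.BirchSwinnertonDyer.BirchSwinnertonDyer.Theorems.ManinLocalTwoThreeTameThreeTorsionCongruence
import Literature.NumberTheory.EllipticCurves.IsogenyDualProofs
import Literature.NumberTheory.EllipticCurves.CuspFormLFunctionLevelConductorProofs
import Literature.NumberTheory.EllipticCurves.ModularCurveManinSemistableBridgeProofs
import HarnessLib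

/-!
# E-an-109 for rational `3`-lines on the tame `I₀*` stratum, parity form: `u = 1 ⟺ ord₃ D₀ odd (= 3)`, `u = 3 ⟺ ord₃ D₀ even (= 0)`

Summit `BirchSwinnertonDyer`, route `ManinLocalTwoThree` (cell bsd-f2-manin), deciding crux C3 `ManinPrimeToThreeAtNine`
(stmt-BirchSwinnertonDyer-22968).  `W/ℚ` globally minimal, `9 ∥ N`, `ord₃ Δ_min = 6` (tame `I₀*`), `q` a rational `3`-LINE (`Ψ₃_W(q − b₂/12) = 0`; the
kernel need not consist of rational points — e.g. `μ₃`-kernels), `D₀ = Ψ₂²_W(q − b₂/12)`, `(A, B)` the `u = 1` Vélu pair.  an's law E-an-109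
(MEMO-an §66: «`I₀*`: `u = 1 ⟺ v₃D₀` odd», census) from this seat's pieces: the local dichotomy p652435 (`ord₃ D₀ = 0 ∧ (A = 0 ∨ ord₃ A ≥ 4)`
or `ord₃ D₀ ≥ 3`), the isogenous dichotomy p648212 (a globally minimal `W′ ∼ W` and `k ∣ 3` with `k⁴c₄(W′) = A`, …,
`ord₃ Δ_min(W′) + 4·ord₃ D₀ + 12·ord₃ k = 18`), the every-prime bookkeeping p645802, and — for the even branch only — conductor invariance
(`exists_isNewformOf` + a newform of `W`) with the tame classification p650740/p651737 (`I₁₂*` has `ord₃ j = −12`):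

* `IstarZero_velu_three_of_odd` (UNCONDITIONAL) — `ord₃ D₀` odd ⟹ `ord₃ D₀ = 3`, an ISOGENOUS globally minimal `W′` carries `(A, B)` itself
  (`u = 1`, `ord₃ Δ_min(W′) = 6`: `I₀* → I₀*`), and NO globally minimal curve carries `(3⁻⁴A, 3⁻⁶B)`.
* `IstarZero_velu_three_of_even` (granted `exists_isNewformOf`) — `ord₃ D₀` even ⟹ `ord₃ D₀ = 0`, an ISOGENOUS globally minimal `W′` carries
  `(3⁻⁴A, 3⁻⁶B)` (`u = 3`), and no ISOGENOUS globally minimal curve carries `(A, B)`.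

(Rational `3`-torsion POINTS have `D₀ = 4Y₁²`, even order: the lead's `…TameThreeTorsionAscends` (unconditional, via the flex congruence);
this file treats all rational lines.)  HONEST FRAMING: local/structural; C3, Manin's conjecture and BSD are not proved.  No definitions, no named
facts, no sorry.  References: [SilvermanATAEC1994] IV.9.4 Table 4.1; [DokchitserDokchitser2015LocalInvariants] Table 1; [AtkinLehner1970] Thm. 4;
HOME/MEMO-an.md §66 (E-an-109), §68.9.
-/

set_option linter.dupNamespace false
set_option autoImplicit false

noncomputable section

open scoped Classical

open WeierstrassCurve Polynomial CongruenceSubgroup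
  Literature.NumberTheory.EllipticCurves Literature.NumberTheory.EllipticCurves.ModularForms
  Summit.BirchSwinnertonDyer.Rank1Residual.Additive

namespace Summit.BirchSwinnertonDyer.BirchSwinnertonDyer.Theorems.ManinLocalTwoThree

/-- On tame `I₀*`, NO globally minimal curve carries the thrice-divided pair of a rational `3`-line with `ord₃ D₀ ≥ 2`
(`ord₃ Δ_min(W′) = 6 − 4·ord₃ D₀ < 0`). [cite: DokchitserDokchitser2015LocalInvariants, Table 1] -/
theorem not_exists_three_velu_three_of_IstarZero_of_two_le (W : WeierstrassCurve ℚ) [W.IsElliptic] [W.IsGloballyMinimal]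
    (hΔ6 : padicValInt 3 W.minimalDiscriminantInt = 6) (q : ℚ) (hq : W.Ψ₃.eval (q - W.b₂ / 12) = 0)
    (hD : 2 ≤ padicValRat 3 (W.Ψ₂Sq.eval (q - W.b₂ / 12))) :
    ¬ ∃ W' : WeierstrassCurve ℚ, W'.IsElliptic ∧ W'.IsGloballyMinimal ∧
        (3 : ℚ) ^ 4 * W'.c₄ = 1440 * q ^ 2 - 9 * W.c₄ ∧
        (3 : ℚ) ^ 6 * W'.c₆ = 60480 * q ^ 3 - 756 * W.c₄ * q - 27 * W.c₆ := by
  rintro ⟨W', _, _, h4, h6⟩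
  haveI : Fact (Nat.Prime 3) := ⟨Nat.prime_three⟩
  set C : VariableChange ℚ := ⟨Units.mk0 (3 : ℚ)⁻¹ (inv_ne_zero three_ne_zero), 0, 0, 0⟩ with hC
  have hu : ((C.u⁻¹ : ℚˣ) : ℚ) = 3 := by rw [Units.val_inv_eq_inv_val, hC, Units.val_mk0, inv_inv]
  have hT4 : (C • W').c₄ = 1440 * q ^ 2 - 9 * W.c₄ := by rw [variableChange_c₄, hu, ← h4]
  have hT6 : (C • W').c₆ = 60480 * q ^ 3 - 756 * W.c₄ * q - 27 * W.c₆ := by rw [variableChange_c₆, hu, ← h6]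
  have hTΔ : (C • W').Δ = 3 ^ 12 * (W'.minimalDiscriminantInt : ℚ) := by
    rw [variableChange_Δ, hu, cast_minimalDiscriminantInt]
  have h := padicValRat_velu_three_Δ 3 W q hq (C • W') hT4 hT6
  have hm0 : (W'.minimalDiscriminantInt : ℚ) ≠ 0 := by exact_mod_cast minimalDiscriminantInt_ne_zero W'
  have h3v : padicValRat 3 (3 : ℚ) = 1 := by exact_mod_cast padicValRat.self (p := 3) (by norm_num)
  rw [hTΔ, padicValRat.mul (pow_ne_zero _ three_ne_zero) hm0, padicValRat.pow (3 : ℚ), h3v, padicValRat.of_int,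
    ← cast_minimalDiscriminantInt W, padicValRat.of_int, hΔ6] at h
  push_cast at h
  have hnn : (0 : ℤ) ≤ padicValInt 3 W'.minimalDiscriminantInt := Nat.cast_nonneg _
  omega

/-- **E-an-109, odd branch (UNCONDITIONAL): on tame `I₀*` a rational `3`-line with `ord₃ D₀` odd has `ord₃ D₀ = 3`, an ISOGENOUS globally
minimal `u = 1` carrier of Kodaira type `I₀*` (`ord₃ Δ_min = 6`), and no `u = 3` carrier.**
[cite: SilvermanATAEC1994, IV.9.4 Table 4.1] [cite: DokchitserDokchitser2015LocalInvariants, Table 1] -/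
theorem IstarZero_velu_three_of_odd (W : WeierstrassCurve ℚ) [W.IsElliptic] [W.IsGloballyMinimal]
    (h9 : 3 ^ 2 ∣ W.conductorNorm ℤ) (h27 : ¬ 3 ^ 3 ∣ W.conductorNorm ℤ) (hΔ6 : padicValInt 3 W.minimalDiscriminantInt = 6)
    (q : ℚ) (hq : W.Ψ₃.eval (q - W.b₂ / 12) = 0) (hodd : Odd (padicValRat 3 (W.Ψ₂Sq.eval (q - W.b₂ / 12)))) :
    padicValRat 3 (W.Ψ₂Sq.eval (q - W.b₂ / 12)) = 3 ∧
      (∃ (W' : WeierstrassCurve ℚ) (_ : W'.IsElliptic) (_ : W'.IsGloballyMinimal), IsIsogenous W W' ∧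
        W'.c₄ = 1440 * q ^ 2 - 9 * W.c₄ ∧ W'.c₆ = 60480 * q ^ 3 - 756 * W.c₄ * q - 27 * W.c₆ ∧
        padicValInt 3 W'.minimalDiscriminantInt = 6) ∧
      ¬ ∃ W' : WeierstrassCurve ℚ, W'.IsElliptic ∧ W'.IsGloballyMinimal ∧
        (3 : ℚ) ^ 4 * W'.c₄ = 1440 * q ^ 2 - 9 * W.c₄ ∧
        (3 : ℚ) ^ 6 * W'.c₆ = 60480 * q ^ 3 - 756 * W.c₄ * q - 27 * W.c₆ := by
  haveI : Fact (Nat.Prime 3) := ⟨Nat.prime_three⟩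
  -- local dichotomy: `ord₃ D₀ = 0` is even, so `ord₃ D₀ ≥ 3`
  have hD3 : 3 ≤ padicValRat 3 (W.Ψ₂Sq.eval (q - W.b₂ / 12)) := by
    rcases veluD₀_dichotomy_of_IstarZero_three W h9 h27 hΔ6 q hq with ⟨h0, -⟩ | h
    · exfalso; rw [h0] at hodd; exact (Int.not_odd_iff_even.mpr (by decide)) hodd
    · exact h
  have hno := not_exists_three_velu_three_of_IstarZero_of_two_le W hΔ6 q hq (by omega)
  -- the isogenous carrier has `k = ±1`
  obtain ⟨W', k, hE', hM', hiso, hk, hk0, h4', h6', hbook⟩ := exists_isIsogenous_dvd_three_velu_three W q hq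
  haveI := hE'; haveI := hM'
  have hb := hbook 3
  rw [hΔ6] at hb
  push_cast at hb
  have hnn : (0 : ℤ) ≤ padicValInt 3 W'.minimalDiscriminantInt := Nat.cast_nonneg _
  have hkv : (0 : ℤ) ≤ padicValInt 3 k := Nat.cast_nonneg _
  rcases eq_or_eq_of_int_dvd_three hk with hk1 | hk3
  · have hkval : padicValInt 3 k = 0 := by rcases hk1 with rfl | rfl <;> simp [padicValInt]
    rw [hkval] at hb
    push_cast at hb
    have hk4 : (k : ℚ) ^ 4 = 1 := by rcases hk1 with rfl | rfl <;> norm_num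
    have hk6 : (k : ℚ) ^ 6 = 1 := by rcases hk1 with rfl | rfl <;> norm_num
    rw [hk4, one_mul] at h4'
    rw [hk6, one_mul] at h6'
    -- `ord₃ Δ_min(W′) = 18 − 4·ord₃ D₀ ≥ 0` with `ord₃ D₀ ≥ 3` odd forces `ord₃ D₀ = 3`
    obtain ⟨m, hm⟩ := hodd
    have hv3 : padicValRat 3 (W.Ψ₂Sq.eval (q - W.b₂ / 12)) = 3 := by omega
    exact ⟨hv3, ⟨W', hE', hM', hiso, h4', h6', by omega⟩, hno⟩
  · exfalso
    have hk4 : (k : ℚ) ^ 4 = 3 ^ 4 := by rcases hk3 with rfl | rfl <;> norm_num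
    have hk6 : (k : ℚ) ^ 6 = 3 ^ 6 := by rcases hk3 with rfl | rfl <;> norm_num
    rw [hk4] at h4'
    rw [hk6] at h6'
    exact hno ⟨W', hE', hM', h4', h6'⟩

/-- **E-an-109, even branch (granted `exists_isNewformOf` and a newform of `W`): on tame `I₀*` a rational `3`-line with `ord₃ D₀` even has
`ord₃ D₀ = 0`, an ISOGENOUS globally minimal `u = 3` carrier, and no isogenous `u = 1` carrier** (that one would be `I₁₂*` with `ord₃ j = −12`,
against `j = A³/Δ`, `ord₃ A ≥ 4` or `A = 0`). [cite: SilvermanATAEC1994, IV.9.4 Table 4.1] [cite: AtkinLehner1970, Thm. 4] -/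
theorem IstarZero_velu_three_of_even (hnf : exists_isNewformOf) (W : WeierstrassCurve ℚ) [W.IsElliptic] [W.IsGloballyMinimal]
    {N : ℕ} [NeZero N] {f : CuspForm (Gamma0 N) 2} (hf : IsNewformOf W f) (h9 : 3 ^ 2 ∣ N) (h27 : ¬ 3 ^ 3 ∣ N)
    (hΔ6 : padicValInt 3 W.minimalDiscriminantInt = 6) (q : ℚ) (hq : W.Ψ₃.eval (q - W.b₂ / 12) = 0)
    (heven : Even (padicValRat 3 (W.Ψ₂Sq.eval (q - W.b₂ / 12)))) :
    padicValRat 3 (W.Ψ₂Sq.eval (q - W.b₂ / 12)) = 0 ∧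
      (∃ (W' : WeierstrassCurve ℚ) (_ : W'.IsElliptic) (_ : W'.IsGloballyMinimal), IsIsogenous W W' ∧
        (3 : ℚ) ^ 4 * W'.c₄ = 1440 * q ^ 2 - 9 * W.c₄ ∧
        (3 : ℚ) ^ 6 * W'.c₆ = 60480 * q ^ 3 - 756 * W.c₄ * q - 27 * W.c₆) ∧
      ¬ ∃ (W' : WeierstrassCurve ℚ) (_ : W'.IsElliptic) (_ : W'.IsGloballyMinimal), IsIsogenous W W' ∧
        W'.c₄ = 1440 * q ^ 2 - 9 * W.c₄ ∧ W'.c₆ = 60480 * q ^ 3 - 756 * W.c₄ * q - 27 * W.c₆ := by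
  haveI : Fact (Nat.Prime 3) := ⟨Nat.prime_three⟩
  have hN : N = W.conductorNorm ℤ := IsNewformOf.level_eq_conductorNorm_of_exists_isNewformOf hnf hf
  have h9W : 3 ^ 2 ∣ W.conductorNorm ℤ := hN ▸ h9
  have h27W : ¬ 3 ^ 3 ∣ W.conductorNorm ℤ := hN ▸ h27
  -- conductor invariance along any isogeny out of `W`
  have htame : ∀ (W' : WeierstrassCurve ℚ) [W'.IsElliptic], IsIsogenous W W' →
      3 ^ 2 ∣ W'.conductorNorm ℤ ∧ ¬ 3 ^ 3 ∣ W'.conductorNorm ℤ := fun W' _ hiso ↦ by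
    have hN' : N = W'.conductorNorm ℤ :=
      IsNewformOf.level_eq_conductorNorm_of_exists_isNewformOf hnf (hf.of_isIsogenous hiso.symm_of_charZero)
    exact ⟨hN' ▸ h9, hN' ▸ h27⟩
  -- no ISOGENOUS `u = 1` carrier when `ord₃ D₀ = 0` and `A = 0 ∨ ord₃ A ≥ 4`
  have hnoMin : padicValRat 3 (W.Ψ₂Sq.eval (q - W.b₂ / 12)) = 0 →
      (1440 * q ^ 2 - 9 * W.c₄ = 0 ∨ 4 ≤ padicValRat 3 (1440 * q ^ 2 - 9 * W.c₄)) →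
      ¬ ∃ (W' : WeierstrassCurve ℚ) (_ : W'.IsElliptic) (_ : W'.IsGloballyMinimal), IsIsogenous W W' ∧
        W'.c₄ = 1440 * q ^ 2 - 9 * W.c₄ ∧ W'.c₆ = 60480 * q ^ 3 - 756 * W.c₄ * q - 27 * W.c₆ := by
    rintro hD0 hA ⟨W', hE', hM', hiso, hc4, hc6⟩
    have hb := padicValRat_velu_three_Δ 3 W q hq W' hc4 hc6
    rw [hD0, ← cast_minimalDiscriminantInt W', ← cast_minimalDiscriminantInt W, padicValRat.of_int, padicValRat.of_int, hΔ6] at hb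
    push_cast at hb
    have hδ' : padicValInt 3 W'.minimalDiscriminantInt = 18 := by omega
    obtain ⟨h9', h27'⟩ := htame W' hiso
    have hj : padicValRat 3 W'.j = -12 := by
      rcases nine_dvd_conductorNorm_classification W' h9' h27' with ⟨-, h⟩ | ⟨-, h⟩ | ⟨-, h⟩ | ⟨n, -, h, hjn⟩
      · omega
      · omega
      · omega
      · have hn : n = 11 := by omega
        subst hn; rw [hjn]; norm_num
    rcases hA with hA0 | hA4
    · have hj0 : W'.j = 0 := by rw [WeierstrassCurve.j, hc4, hA0]; ring
      rw [hj0, padicValRat.zero] at hj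
      norm_num at hj
    · have hc₄ne : W'.c₄ ≠ 0 := by
        intro h0; rw [← hc4, h0, padicValRat.zero] at hA4; norm_num at hA4
      rw [padicValRat_three_j_eq W' hc₄ne, hc4, ← cast_minimalDiscriminantInt W', padicValRat.of_int, hδ'] at hj
      push_cast at hj
      omega
  -- the local dichotomy
  rcases veluD₀_dichotomy_of_IstarZero_three W h9W h27W hΔ6 q hq with ⟨hD0, hA⟩ | hD3
  · refine ⟨hD0, ?_, hnoMin hD0 hA⟩
    obtain ⟨W', k, hE', hM', hiso, hk, hk0, h4', h6', -⟩ := exists_isIsogenous_dvd_three_velu_three W q hq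
    haveI := hE'; haveI := hM'
    rcases eq_or_eq_of_int_dvd_three hk with hk1 | hk3
    · exfalso
      have hk4 : (k : ℚ) ^ 4 = 1 := by rcases hk1 with rfl | rfl <;> norm_num
      have hk6 : (k : ℚ) ^ 6 = 1 := by rcases hk1 with rfl | rfl <;> norm_num
      rw [hk4, one_mul] at h4'
      rw [hk6, one_mul] at h6'
      exact hnoMin hD0 hA ⟨W', hE', hM', hiso, h4', h6'⟩
    · have hk4 : (k : ℚ) ^ 4 = 3 ^ 4 := by rcases hk3 with rfl | rfl <;> norm_num
      have hk6 : (k : ℚ) ^ 6 = 3 ^ 6 := by rcases hk3 with rfl | rfl <;> norm_num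
      rw [hk4] at h4'
      rw [hk6] at h6'
      exact ⟨W', hE', hM', hiso, h4', h6'⟩
  · -- `ord₃ D₀ ≥ 3` even ⟹ `≥ 4`: every isogenous carrier has `ord₃ Δ_min ≤ 2`, not a tame value
    exfalso
    have hD4 : 4 ≤ padicValRat 3 (W.Ψ₂Sq.eval (q - W.b₂ / 12)) := by
      obtain ⟨m, hm⟩ := heven; omega
    obtain ⟨W', k, hE', hM', hiso, hk, hk0, h4', h6', hbook⟩ := exists_isIsogenous_dvd_three_velu_three W q hq
    haveI := hE'; haveI := hM'
    have hb := hbook 3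
    rw [hΔ6] at hb
    push_cast at hb
    have hkv : (0 : ℤ) ≤ padicValInt 3 k := Nat.cast_nonneg _
    obtain ⟨h9', h27'⟩ := htame W' hiso
    have hδ'3 : 3 ≤ padicValInt 3 W'.minimalDiscriminantInt := by
      rcases nine_dvd_conductorNorm_classification W' h9' h27' with ⟨-, h⟩ | ⟨-, h⟩ | ⟨-, h⟩ | ⟨n, -, h, -⟩ <;> omega
    omega

end Summit.BirchSwinnertonDyer.BirchSwinnertonDyer.Theorems.ManinLocalTwoThree

end
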